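import Literature.NumberTheory.Rogawski1990.ArchBouazizClassMapG              -- ★ (7) F0 (LH3-p04 (g7)) p851983: `esymm3`, `esymm3_comp_equiv`, `cubicDisc_esymm3_ne_zero_iff`
import HarnessLib

/-!
# Trichotomy of the elliptic base classes of `U(2,1)`: REGULAR (three distinct unit eigenvalues) ∕ WALL (`esymm3 (u,u,v)`, `u ≠ v`) ∕ SCALAR CORNER (`esymm3 (ζ,ζ,ζ)`) — the case split
# by which the EP assembly's binder `hEP : ∀ l unit, EPGeneratorAt … (esymm3 l)` is discharged from the three one-place generators (7) (8) (10) (Rogawski 1990 §3.6, §8.2; Shelstad 1979 §4)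

Topic `NumberTheory/Rogawski1990`; namespace `Literature.NumberTheory.Rogawski1990`.  THEOREMS ONLY (no `def`, no instance, no notation, no axiom, no named fact, no `sorry`); pure
combinatorics of a triple + ★ `esymm3_comp_equiv`.  Cell `pub/hodgecm-mathlib`, crux H413 (`stmt-HodgeConjecture-24833`), F0∕P3c road «N8-INNER» ROAD B «EP road» (owner LH2-plan (g1)),
brick (12′) «EP ASSEMBLY» (LH7-p01 (g7)) — adapter offered by LH3-p04 (g7) ((7) F7′ holder, ★ p852141 `epGeneratorAt_esymm3_of_injective` is the REGULAR input).  Count-neutral.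

THE POINT.  E3's hypothesis (A4, LH7-p01 16:25:01Z) reads `hEP : ∀ w ∈ D, ∀ l : Fin 3 → ℂ, (∀ i, ‖l i‖ = 1) → EPGeneratorAt L β w ν_w (esymm3 l)`; the generators conclude it at
`esymm3 l` with `l` injective ((7) ★), at `esymm3 ![u, u, v]` with `u ≠ v` ((8)), and at `esymm3 (fun _ => ζ)` ((10)(C′)).  Since `esymm3` is symmetric (★ `esymm3_comp_equiv`), every
unit triple falls in exactly one of the three shapes up to relabelling — so three shape-wise hypotheses give the binder (`forall_esymm3_of_regular_wall_corner`, generic in the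
predicate `P` on class space so that it serves `P := EPGeneratorAt L β w ν_w` and any other class-indexed head alike).
* `triple_trichotomy` — a triple `l : Fin 3 → X` is injective, or constant, or `l ∘ τ = ![u, u, v]` with `u ≠ v` for some permutation `τ`.
* `esymm3_trichotomy` — the same read through `esymm3` (`esymm3 l = esymm3 ![u, u, v]`).
* **`forall_esymm3_of_regular_wall_corner`**, **`forall_unit_esymm3_of_regular_wall_corner`** (unit triples, `‖u‖ = ‖v‖ = ‖ζ‖ = 1` handed to the shape hypotheses),
  `forall_unit_esymm3_of_regular_wall_corner_circle` (the `Circle`-valued spelling of (10)(C′)'s head `(ζ : Circle)`).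
HONEST LABEL: HC_CM is proved only modulo the 7 printed citations (2 remaining: hLiu418 = `stmt-HodgeConjecture-24832`, h413 = `stmt-HodgeConjecture-24833`) until rung 0 closes; bookkeeping only.

## References
* [Rogawski1990] J. D. Rogawski, *Automorphic Representations of Unitary Groups in Three Variables*, Ann. of Math. Stud. 123 (1990), §3.6 p. 28 (regular, singular and central elliptic
  elements of `U(2,1)`), §8.2 p. 122.
* [Shelstad1979] D. Shelstad, *Characters and inner forms of a quasi-split group over ℝ*, Compositio Math. 39 (1979), §4 pp. 22–26 (the walls of the compact Cartan).
-/

set_option autoImplicit false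

noncomputable section

open Complex Function

namespace Literature.NumberTheory.Rogawski1990

section Trichotomy

variable {X : Type*}

/-- **Trichotomy of a triple**: `l : Fin 3 → X` is injective, or constant, or — after a relabelling `τ ∈ S₃` — of the WALL shape `![u, u, v]` with `u ≠ v`. [cite: Rogawski1990, §3.6 p. 28] -/
theorem triple_trichotomy (l : Fin 3 → X) :
    Function.Injective l ∨ (∃ ζ : X, l = fun _ => ζ) ∨ (∃ (τ : Equiv.Perm (Fin 3)) (u v : X), u ≠ v ∧ l ∘ τ = ![u, u, v]) := by
  classical
  by_cases h01 : l 0 = l 1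
  · by_cases h12 : l 1 = l 2
    · -- constant
      refine Or.inr (Or.inl ⟨l 0, funext fun i => ?_⟩)
      fin_cases i
      · rfl
      · exact h01.symm
      · exact (h01.trans h12).symm
    · -- wall `(l0, l0, l2)`, `τ = 1`
      refine Or.inr (Or.inr ⟨1, l 0, l 2, fun h => h12 (h01.symm.trans h), funext fun i => ?_⟩)
      fin_cases i
      · rfl
      · exact h01.symm
      · rfl
  · by_cases h02 : l 0 = l 2
    · -- wall `(l0, l2, l1)` after swapping `1, 2`
      refine Or.inr (Or.inr ⟨Equiv.swap 1 2, l 0, l 1, h01, funext fun i => ?_⟩)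
      fin_cases i
      · show l (Equiv.swap (1 : Fin 3) 2 0) = l 0
        rw [Equiv.swap_apply_of_ne_of_ne (by decide) (by decide)]
      · show l (Equiv.swap (1 : Fin 3) 2 1) = l 0
        rw [Equiv.swap_apply_left]; exact h02.symm
      · show l (Equiv.swap (1 : Fin 3) 2 2) = l 1
        rw [Equiv.swap_apply_right]
    · by_cases h12 : l 1 = l 2
      · -- wall `(l1, l2, l0)` after the relabelling `0 ↦ 1 ↦ 2 ↦ 0`… simplest: swap `0, 2`: `(l2, l1, l0) = (u, u, v)` with `u = l2 = l1`, `v = l0`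
        refine Or.inr (Or.inr ⟨Equiv.swap 0 2, l 1, l 0, fun h => h01 h.symm, funext fun i => ?_⟩)
        fin_cases i
        · show l (Equiv.swap (0 : Fin 3) 2 0) = l 1
          rw [Equiv.swap_apply_left]; exact h12.symm
        · show l (Equiv.swap (0 : Fin 3) 2 1) = l 1
          rw [Equiv.swap_apply_of_ne_of_ne (by decide) (by decide)]
        · show l (Equiv.swap (0 : Fin 3) 2 2) = l 0
          rw [Equiv.swap_apply_right]
      · -- all distinct: injective
        refine Or.inl fun i j hij => ?_
        fin_cases i <;> fin_cases j
        · rfl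
        · exact absurd hij h01
        · exact absurd hij h02
        · exact absurd hij.symm h01
        · rfl
        · exact absurd hij h12
        · exact absurd hij.symm h02
        · exact absurd hij.symm h12
        · rfl

/-- **Trichotomy of an elliptic class**: `esymm3 l` is the class of an injective triple, of a scalar triple, or of a wall triple `![u, u, v]` (`u ≠ v`) — `esymm3` being symmetric
(★ `esymm3_comp_equiv`). [cite: Rogawski1990, §3.6 p. 28] [cite: Shelstad1979, §4 p. 22] -/
theorem esymm3_trichotomy (l : Fin 3 → ℂ) :
    Function.Injective l ∨ (∃ ζ : ℂ, l = fun _ => ζ) ∨ (∃ u v : ℂ, u ≠ v ∧ (∃ i, l i = u) ∧ (∃ j, l j = v) ∧ esymm3 l = esymm3 ![u, u, v]) := by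
  rcases triple_trichotomy l with h | h | ⟨τ, u, v, huv, hl⟩
  · exact Or.inl h
  · exact Or.inr (Or.inl h)
  · refine Or.inr (Or.inr ⟨u, v, huv, ⟨τ 0, ?_⟩, ⟨τ 2, ?_⟩, ?_⟩)
    · exact (congrFun hl 0 :)
    · exact (congrFun hl 2 :)
    · rw [← esymm3_comp_equiv l τ, hl]

/-- **THREE SHAPE-WISE HYPOTHESES GIVE A CLASS-INDEXED HEAD AT EVERY ELLIPTIC CLASS** (generic predicate `P` on class space `ℂ³`; for the EP assembly `P := EPGeneratorAt L β w ν_w`, fed by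
(7) ★ `epGeneratorAt_esymm3_of_injective`, (8) «WALL», (10) «CORNER»). [cite: Rogawski1990, §8.2 p. 122] [cite: Shelstad1979, §4 p. 22] -/
theorem forall_esymm3_of_regular_wall_corner {P : ℂ × ℂ × ℂ → Prop} {Q : ℂ → Prop}
    (hreg : ∀ l : Fin 3 → ℂ, (∀ i, Q (l i)) → Function.Injective l → P (esymm3 l))
    (hwall : ∀ u v : ℂ, Q u → Q v → u ≠ v → P (esymm3 ![u, u, v]))
    (hcorner : ∀ ζ : ℂ, Q ζ → P (esymm3 fun _ : Fin 3 => ζ)) :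
    ∀ l : Fin 3 → ℂ, (∀ i, Q (l i)) → P (esymm3 l) := by
  intro l hl
  rcases esymm3_trichotomy l with h | ⟨ζ, rfl⟩ | ⟨u, v, huv, ⟨i, hi⟩, ⟨j, hj⟩, hcls⟩
  · exact hreg l hl h
  · exact hcorner ζ (hl 0)
  · rw [hcls]
    exact hwall u v (hi ▸ hl i) (hj ▸ hl j) huv

/-- **The unit-triple form** (`Q := (‖·‖ = 1)`): the shape E3's binder `hEP : ∀ l, (∀ i, ‖l i‖ = 1) → EPGeneratorAt L β w ν_w (esymm3 l)` is discharged in.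
[cite: Rogawski1990, §8.2 p. 122] [cite: Shelstad1979, §4 p. 22] -/
theorem forall_unit_esymm3_of_regular_wall_corner {P : ℂ × ℂ × ℂ → Prop}
    (hreg : ∀ l : Fin 3 → ℂ, (∀ i, ‖l i‖ = 1) → Function.Injective l → P (esymm3 l))
    (hwall : ∀ u v : ℂ, ‖u‖ = 1 → ‖v‖ = 1 → u ≠ v → P (esymm3 ![u, u, v]))
    (hcorner : ∀ ζ : ℂ, ‖ζ‖ = 1 → P (esymm3 fun _ : Fin 3 => ζ)) :
    ∀ l : Fin 3 → ℂ, (∀ i, ‖l i‖ = 1) → P (esymm3 l) :=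
  forall_esymm3_of_regular_wall_corner (Q := fun z : ℂ => ‖z‖ = 1) hreg hwall hcorner

/-- **The `Circle`-valued spelling** of the wall and corner hypotheses (as (10)(C′)'s head `(ζ : Circle) : EPGeneratorAt … (esymm3 fun _ => (ζ : ℂ))`).
[cite: Rogawski1990, §8.2 p. 122] [cite: Shelstad1979, §4 p. 22] -/
theorem forall_unit_esymm3_of_regular_wall_corner_circle {P : ℂ × ℂ × ℂ → Prop}
    (hreg : ∀ l : Fin 3 → ℂ, (∀ i, ‖l i‖ = 1) → Function.Injective l → P (esymm3 l))
    (hwall : ∀ u v : Circle, u ≠ v → P (esymm3 ![(u : ℂ), (u : ℂ), (v : ℂ)]))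
    (hcorner : ∀ ζ : Circle, P (esymm3 fun _ : Fin 3 => (ζ : ℂ))) :
    ∀ l : Fin 3 → ℂ, (∀ i, ‖l i‖ = 1) → P (esymm3 l) := by
  refine forall_unit_esymm3_of_regular_wall_corner hreg (fun u v hu hv huv => ?_) (fun ζ hζ => ?_)
  · -- `u = e^{iθ}`, `v = e^{iφ}` as points of `Circle`
    obtain ⟨θ, hθ⟩ := (Complex.norm_eq_one_iff u).1 hu
    obtain ⟨φ, hφ⟩ := (Complex.norm_eq_one_iff v).1 hv
    have h := hwall (Circle.exp θ) (Circle.exp φ) fun h => huv (by rw [← hθ, ← hφ, ← Circle.coe_exp, ← Circle.coe_exp, h])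
    rwa [Circle.coe_exp, Circle.coe_exp, hθ, hφ] at h
  · obtain ⟨θ, hθ⟩ := (Complex.norm_eq_one_iff ζ).1 hζ
    have h := hcorner (Circle.exp θ)
    rwa [Circle.coe_exp, hθ] at h

end Trichotomy

end Literature.NumberTheory.Rogawski1990

end
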